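import Literature.Probability.Percolation.KozmaNitzanSeparatingTriple
import HarnessLib

/-!
# `NoHeavyLowerTail` (stmt-CriticalPhenomena-4575) — the decodable `(o,b)`-block is RANK ONE on the separating face

Support file (prover `prim-lf-7` gen 5, lemma factory #7; `--supports stmt-CriticalPhenomena-4575`).  No named facts, no
sorries; two definitions of EVENTS (`blockCellOf`, its patterns `bPattern`/`tPattern`), no new notion.

Setting: Kozma–Nitzan's Theorem-3 data `S : KNSep.SepData V` (arXiv:2401.12397, p. 10; tree file
`Literature/Probability/Percolation/KozmaNitzanSeparatingTriple.lean`): weights `S.w`, observer `S.o` inside the `B`-side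
interior `S.VB`, three relays `S.A = {a₁,a₂,a₃}` and a target `S.b` off `VB`, and no positive weight across (the relays
SEPARATE `o` from `b`).  For `X, T ⊆ V` the BLOCK CELL `blockCellOf A o b X T` is the event
  "`o ↔ a` exactly for the relays `a ∈ X`,  `a ↔ b` exactly for the relays `a ∈ T`,  the relays are pairwise NOT connected,
   and `o ↔ b` iff some relay lies in `X ∩ T`"
— for `X, T ∈ {∅, {a₁}, {a₂}, {a₃}}` these are the 16 cells of the 5-terminal connection law (wf3lp/gz 52-cell coordinates)
in which every relay block is a singleton, with `o` attached to at most one relay and `b` to at most one relay (the cell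
`o aᵢ b | aⱼ | aₖ` is `X = T = {aᵢ}`); for other `X, T` the event is empty or one of these.

* `real_blockCell` (PRODUCT FORM): `μ(blockCell X T) = P(B-pattern X) · P(T-pattern T)`, where the `B`-pattern reads the
  `B`-connectivity `S.rb` ("`o ↔_B a` iff `a ∈ X`, relays pairwise not `B`-connected") and the `T`-pattern the unglued
  `T`-connectivity `S.rt ∅` ("`a ↔_T b` iff `a ∈ T`, relays pairwise not `T`-connected").  Proof: on the almost-sure set
  `KNSep.sureSet S.w` (no open cross pair) the block cell IS the intersection of the two pattern events — by the amalgamation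
  lemmas `KNSep.reachable_iff_rT` / `KNSep.reachable_iff_exists_rB_rT` with glue set `∅` (`SepData.glue_cM`) — and the two
  sides are independent (`SepData.real_inter_rb_rt`).
* `blockCell_rankOne` (RANK ONE): `μ(cell X T)·μ(cell X' T') = μ(cell X T')·μ(cell X' T)` for all `X, X', T, T'`: every
  2×2 minor of the 4×4 block `M[X][T]` vanishes on the separating face; in particular (`blockCell_defect_eq_zero`)
  `μ(o aᵢ b|·|·)·μ(all separate) = μ(o aᵢ|·|·|b)·μ(aᵢ b|o|·|·)`.
* `blockCell_rankOne_of_parts`: the same with the separation given as a partition (`VB`), as in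
  `KozmaNitzan2024_thm3_of_parts`.

Why it is here (memo `run/shared/lean/prim/prim-lf-7/RANK-ONE.md`): these nine quadratic EQUALITIES are the cleanest
single-law consequence of the `B ⊗ T` factorisation that Kozma–Nitzan's proof of Theorem 3 uses and that no row family of the
LP programme for `(U₁)₃` = KN (3) at `|A| = 3` contains; every published pseudo-law violates them by 5–40× its distance to the
face.  Off the face the defect `M_ii M_∅∅ − M_i∅ M_∅i` is conjecturally at most twice the direct-channel cell `μ(o b|a₁|a₂|a₃)`
(census-validated, constant sharp), which is NOT enough to certify `(U₁)₃` (the pseudo-law re-forms at `−8.0e-4`) — recorded in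
the memo, not used here.
-/

noncomputable section

namespace Summit.CriticalPhenomena.PercolationContinuityZ3.Theorems

open MeasureTheory Set Literature.Probability.LatticeModels Literature.Probability.Percolation
open Literature.Probability.Percolation.KNSep
open scoped Classical

namespace FaceRankOne

variable {V : Type*}

/-- The BLOCK CELL of the decodable `(o,b)`-block for relay set `A`, observer `o`, target `b` and attachment sets `X, T`:
`o ↔ a` exactly for `a ∈ A ∩ X`, `a ↔ b` exactly for `a ∈ A ∩ T`, the relays pairwise disconnected, and `o ↔ b` iff some
relay lies in `X ∩ T`.  For `X, T ∈ {∅,{a₁},{a₂},{a₃}}` these are the 16 cells `M[X][T]` of the memo (e.g. `X = T = {aᵢ}` is the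
cell `o aᵢ b | aⱼ | aₖ`, `X = T = ∅` the cell "all five terminals separate"). -/
def blockCellOf (A : Set V) (o b : V) (X T : Set V) : Set (BondConfig V) :=
  {ω | (∀ a ∈ A, ((openGraph ω).Reachable o a ↔ a ∈ X)) ∧ (∀ a ∈ A, ((openGraph ω).Reachable a b ↔ a ∈ T)) ∧
    (∀ a ∈ A, ∀ a' ∈ A, a ≠ a' → ¬ (openGraph ω).Reachable a a') ∧
    ((openGraph ω).Reachable o b ↔ ∃ a ∈ A, a ∈ X ∧ a ∈ T)}

/-- The block cell of Kozma–Nitzan's Theorem-3 data. -/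
abbrev blockCell (S : SepData V) (X T : Set V) : Set (BondConfig V) := blockCellOf S.A S.o S.b X T

/-- The `B`-side pattern of the block row `X`, read on a connectivity relation `r` (intended: `r = S.rb ω`, connectivity
through `B`-side pairs): `o ↔_B a` iff `a ∈ X`, and the relays are pairwise not `B`-connected. -/
def bPattern (S : SepData V) (X : Set V) (r : V → V → Prop) : Prop :=
  (∀ a ∈ S.A, (r S.o a ↔ a ∈ X)) ∧ (∀ a ∈ S.A, ∀ a' ∈ S.A, a ≠ a' → ¬ r a a')

/-- The `T`-side pattern of the block column `T`, read on a connectivity relation `r` (intended: `r = S.rt ∅ ω`, connectivity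
through `T`-side pairs, nothing glued): `a ↔_T b` iff `a ∈ T`, and the relays are pairwise not `T`-connected. -/
def tPattern (S : SepData V) (T : Set V) (r : V → V → Prop) : Prop :=
  (∀ a ∈ S.A, (r a S.b ↔ a ∈ T)) ∧ (∀ a ∈ S.A, ∀ a' ∈ S.A, a ≠ a' → ¬ r a a')

/-- Unglued `T`-connectivity implies connectivity. -/
theorem reachable_of_rt_empty (S : SepData V) {ω : BondConfig V} {x y : V} (h : S.rt ∅ ω x y) :
    (openGraph ω).Reachable x y :=
  SimpleGraph.Reachable.mono (openGraph_mono (by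
    intro e he
    simp only [Set.union_empty, Set.mem_inter_iff] at he
    exact he.1)) h

/-- On a configuration whose relays are pairwise not `B`-connected the glue set is empty. -/
theorem glueSet_empty_of_sep (S : SepData V) {ω : BondConfig V}
    (hsep : ∀ a ∈ S.A, ∀ a' ∈ S.A, a ≠ a' → ¬ S.rb ω a a') : glueSet S.VB S.A ω = ∅ :=
  S.glue_cM ω ⟨hsep _ S.a₁_mem _ S.a₂_mem S.h₁₂, hsep _ S.a₁_mem _ S.a₃_mem S.h₁₃, hsep _ S.a₂_mem _ S.a₃_mem S.h₂₃⟩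

/-- **Decoding.**  Almost surely (on `sureSet S.w`, where no cross pair is open) the block cell `(X,T)` is exactly the
intersection of the `B`-pattern `X` (an event of the `B`-side pairs) and the unglued `T`-pattern `T` (an event of the
`T`-side pairs). -/
theorem blockCell_inter_sureSet (S : SepData V) (X T : Set V) :
    blockCell S X T ∩ sureSet S.w =
      ({ω | bPattern S X (S.rb ω)} ∩ {ω | tPattern S T (S.rt ∅ ω)}) ∩ sureSet S.w := by
  ext ω
  simp only [mem_inter_iff, mem_setOf_eq]
  constructor
  · rintro ⟨⟨h1, h2, h3, -⟩, hs⟩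
    have hω := S.sureSet_subset_noCross hs
    -- relays pairwise not `B`-connected, hence nothing is glued
    have hsepB : ∀ a ∈ S.A, ∀ a' ∈ S.A, a ≠ a' → ¬ S.rb ω a a' :=
      fun a ha a' ha' hne h => h3 a ha a' ha' hne (rB.reachable h)
    have hglue := glueSet_empty_of_sep S hsepB
    have hsepT : ∀ a ∈ S.A, ∀ a' ∈ S.A, a ≠ a' → ¬ S.rt ∅ ω a a' :=
      fun a ha a' ha' hne h => h3 a ha a' ha' hne (reachable_of_rt_empty S h)
    refine ⟨⟨⟨fun a ha => ⟨fun h => (h1 a ha).1 (rB.reachable h), fun haX => ?_⟩, hsepB⟩, ⟨fun a ha => ?_, hsepT⟩⟩, hs⟩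
    · -- `o ↔ a` through `B`: the amalgamation gives `o ↔_B a' ↔_T a`, and `a' = a` as relays are separated
      obtain ⟨a', ha', hoa', ha'a⟩ :=
        (reachable_iff_exists_rB_rT hω S.ho (S.notMem_VB_of_mem_A ha)).1 ((h1 a ha).2 haX)
      rw [hglue] at ha'a
      by_cases heq : a' = a
      · exact heq ▸ hoa'
      · exact absurd (reachable_of_rt_empty S ha'a) (h3 a' ha' a ha heq)
    · -- `a ↔ b` iff `a ↔_T b` (both off `VB`, nothing glued)
      have key := reachable_iff_rT hω (S.notMem_VB_of_mem_A ha) S.hb (VB := S.VB) (A := S.A) (ω := ω)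
      rw [hglue] at key
      exact key.symm.trans (h2 a ha)
  · rintro ⟨⟨⟨hX, hsepB⟩, ⟨hT, hsepT⟩⟩, hs⟩
    have hω := S.sureSet_subset_noCross hs
    have hglue := glueSet_empty_of_sep S hsepB
    have hreachA : ∀ a ∈ S.A, ∀ y, y ∉ S.VB → ((openGraph ω).Reachable a y ↔ S.rt ∅ ω a y) := by
      intro a ha y hy
      have key := reachable_iff_rT hω (S.notMem_VB_of_mem_A ha) hy (VB := S.VB) (A := S.A) (ω := ω)
      rw [hglue] at key
      exact key
    have hreachO : ∀ y, y ∉ S.VB → ((openGraph ω).Reachable S.o y ↔ ∃ a ∈ S.A, S.rb ω S.o a ∧ S.rt ∅ ω a y) := by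
      intro y hy
      have key := reachable_iff_exists_rB_rT hω S.ho hy (VB := S.VB) (A := S.A) (ω := ω)
      rw [hglue] at key
      exact key
    have h3 : ∀ a ∈ S.A, ∀ a' ∈ S.A, a ≠ a' → ¬ (openGraph ω).Reachable a a' :=
      fun a ha a' ha' hne h => hsepT a ha a' ha' hne ((hreachA a ha a' (S.notMem_VB_of_mem_A ha')).1 h)
    refine ⟨⟨fun a ha => ?_, fun a ha => (hreachA a ha S.b S.hb).trans (hT a ha), h3, ?_⟩, hs⟩
    · constructor
      · intro h
        obtain ⟨a', ha', hoa', ha'a⟩ := (hreachO a (S.notMem_VB_of_mem_A ha)).1 h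
        by_cases heq : a' = a
        · exact (hX a ha).1 (heq ▸ hoa')
        · exact absurd (reachable_of_rt_empty S ha'a) (h3 a' ha' a ha heq)
      · intro haX
        exact (hreachO a (S.notMem_VB_of_mem_A ha)).2 ⟨a, ha, (hX a ha).2 haX, rT_refl _ ω a⟩
    · constructor
      · intro h
        obtain ⟨a', ha', hoa', ha'b⟩ := (hreachO S.b S.hb).1 h
        exact ⟨a', ha', (hX a' ha').1 hoa', (hT a' ha').1 ha'b⟩
      · rintro ⟨a, ha, haX, haT⟩
        exact (hreachO S.b S.hb).2 ⟨a, ha, (hX a ha).2 haX, (hT a ha).2 haT⟩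

variable [Fintype V]

/-- **Product form of the decodable block (separating face).**  For Kozma–Nitzan's Theorem-3 data and all `X, T`:
`μ(blockCell X T) = P(B-pattern X) · P(T-pattern T)` — the block cell probability factorises into a `B`-side factor depending
only on the row `X` and a `T`-side factor depending only on the column `T`. -/
theorem real_blockCell (S : SepData V) (X T : Set V) :
    (prodBernoulli S.w).real (blockCell S X T) =
      (prodBernoulli S.w).real {ω | bPattern S X (S.rb ω)} * (prodBernoulli S.w).real {ω | tPattern S T (S.rt ∅ ω)} := by
  rw [real_eq_of_inter_sureSet S.w (blockCell_inter_sureSet S X T)]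
  exact S.real_inter_rb_rt (bPattern S X) ∅ (tPattern S T)

/-- **The decodable `(o,b)`-block is rank one on the separating face.**  For Kozma–Nitzan's Theorem-3 data (three relays
separating the observer from the target) and all attachment sets `X, X', T, T'`:
`μ(cell X T) · μ(cell X' T') = μ(cell X T') · μ(cell X' T)` — every 2×2 minor of the 4×4 block
`M[X][T] = μ(o-block ∩ A = X, b-block ∩ A = T, relays pairwise separated)` vanishes. -/
theorem blockCell_rankOne (S : SepData V) (X X' T T' : Set V) :
    (prodBernoulli S.w).real (blockCell S X T) * (prodBernoulli S.w).real (blockCell S X' T') =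
      (prodBernoulli S.w).real (blockCell S X T') * (prodBernoulli S.w).real (blockCell S X' T) := by
  rw [real_blockCell, real_blockCell, real_blockCell, real_blockCell]; ring

/-- **Zero rank-one defect on the face** (the diagonal minor `D_a`): for every `a`,
`μ(o a b | · | ·) · μ(all separate) = μ(o a | · | · | b) · μ(a b | o | · | ·)`, i.e. on the separating face the
attachments of `o` and of `b` to the same relay (given all relays separated) are exactly uncorrelated. -/
theorem blockCell_defect_eq_zero (S : SepData V) (a : V) :
    (prodBernoulli S.w).real (blockCell S {a} {a}) * (prodBernoulli S.w).real (blockCell S ∅ ∅) -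
      (prodBernoulli S.w).real (blockCell S {a} ∅) * (prodBernoulli S.w).real (blockCell S ∅ {a}) = 0 := by
  rw [blockCell_rankOne S {a} ∅ {a} ∅]; ring

/-- **Rank one, separation given as a partition** (the hypotheses of `KozmaNitzan2024_thm3_of_parts`): weights `w`, a set
`A` of three relays, `b ∉ A`, a vertex set `VB ∋ o` disjoint from `A` and not containing `b` with no positive weight from `VB`
to the outside of `VB ∪ A`.  Then all 2×2 minors of the block `(X,T) ↦ μ(blockCellOf A o b X T)` vanish. -/
theorem blockCell_rankOne_of_parts (w : Sym2 V → unitInterval) (A : Finset V) (o b : V) (VB : Set V)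
    (hA : A.card = 3) (ho : o ∈ VB) (hb : b ∉ VB) (hbA : b ∉ A) (hAV : ∀ a ∈ A, a ∉ VB)
    (hcut : ∀ e, e ∉ sideB VB (↑A : Set V) → e ∉ sideT VB (↑A : Set V) → w e = 0) (X X' T T' : Set V) :
    (prodBernoulli w).real (blockCellOf (↑A) o b X T) * (prodBernoulli w).real (blockCellOf (↑A) o b X' T') =
      (prodBernoulli w).real (blockCellOf (↑A) o b X T') * (prodBernoulli w).real (blockCellOf (↑A) o b X' T) := by
  obtain ⟨a₁, a₂, a₃, h12, h13, h23, rfl⟩ := Finset.card_eq_three.1 hA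
  have hAset : (↑({a₁, a₂, a₃} : Finset V) : Set V) = ({a₁, a₂, a₃} : Set V) := by simp
  set S : SepData V :=
    { w := w, VB := VB, o := o, b := b, a₁ := a₁, a₂ := a₂, a₃ := a₃, ho := ho, hb := hb
      ha₁ := hAV a₁ (by simp), ha₂ := hAV a₂ (by simp), ha₃ := hAV a₃ (by simp)
      h₁₂ := h12, h₁₃ := h13, h₂₃ := h23
      hb₁ := fun h => hbA (by simp [h]), hb₂ := fun h => hbA (by simp [h]), hb₃ := fun h => hbA (by simp [h])
      hcut := fun e h1 h2 => hcut e (by rwa [hAset]) (by rwa [hAset]) } with hS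
  have hSA : S.A = (↑({a₁, a₂, a₃} : Finset V) : Set V) := by rw [hAset]; rfl
  have key := blockCell_rankOne S X X' T T'
  simp only [blockCell, hSA] at key
  exact key

/-- **Rank one under the printed separation hypothesis** (as in `KozmaNitzan2024_thm3`, arXiv:2401.12397 Thm. 3: "any path in `G`
from `0` to `b` must pass through a point of `A`"): weights `w`, a set `A` of three relays with `o, b ∉ A`, and every walk from `o` to
`b` in the graph of the positive-weight pairs meets `A`.  Then every 2×2 minor of the decodable block
`(X,T) ↦ μ(blockCellOf A o b X T)` vanishes.  Proof: as in `KozmaNitzan2024_thm3`, take `VB = KNSep.observerSide w A o` (the vertices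
reachable from `o` avoiding `A`) and apply `blockCell_rankOne_of_parts`. -/
theorem blockCell_rankOne_of_separating (w : Sym2 V → unitInterval) (A : Finset V) (o b : V)
    (hA : A.card = 3) (hoA : o ∉ A) (hbA : b ∉ A)
    (hsep : ∀ p : (SimpleGraph.fromEdgeSet {e : Sym2 V | w e ≠ 0}).Walk o b, ∃ a ∈ A, a ∈ p.support) (X X' T T' : Set V) :
    (prodBernoulli w).real (blockCellOf (↑A) o b X T) * (prodBernoulli w).real (blockCellOf (↑A) o b X' T') =
      (prodBernoulli w).real (blockCellOf (↑A) o b X T') * (prodBernoulli w).real (blockCellOf (↑A) o b X' T) := by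
  set G := SimpleGraph.fromEdgeSet {e : Sym2 V | w e ≠ 0} with hG
  set VB := observerSide w A o with hVB
  have ho : o ∈ VB := ⟨SimpleGraph.Walk.nil, fun a ha h => hoA (by
    rw [SimpleGraph.Walk.support_nil, List.mem_singleton] at h; exact h ▸ ha)⟩
  have hb : b ∉ VB := fun ⟨p, hp⟩ => by
    obtain ⟨a, ha, hap⟩ := hsep p
    exact hp a ha hap
  have hAV : ∀ a ∈ A, a ∉ VB := fun a ha ⟨p, hp⟩ => hp a ha p.end_mem_support
  refine blockCell_rankOne_of_parts w A o b VB hA ho hb hbA hAV (fun e h1 h2 => ?_) X X' T T'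
  -- a pair from `VB` to the outside of `VB ∪ A` has weight `0` (verbatim the argument of `KozmaNitzan2024_thm3`)
  by_contra hne
  induction e using Sym2.ind with
  | h x y =>
    have key : ∀ u v : V, s(u, v) = s(x, y) → u ∈ VB → v ∉ VB → v ∉ A → False := by
      rintro u v huv ⟨p, hp⟩ hv hvA
      have hadj : G.Adj u v := by
        rw [hG, SimpleGraph.fromEdgeSet_adj]
        refine ⟨by rw [mem_setOf_eq, huv]; exact hne, ?_⟩
        rintro rfl; exact hv ⟨p, hp⟩
      refine hv ⟨p.concat hadj, fun a ha h => ?_⟩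
      rw [SimpleGraph.Walk.support_concat, List.mem_append, List.mem_singleton] at h
      rcases h with h | rfl
      · exact hp a ha h
      · exact hvA ha
    by_cases hx : x ∈ VB
    · by_cases hy : y ∈ VB
      · exact h1 fun v hv => by
          rcases Sym2.mem_iff.1 hv with rfl | rfl
          · exact Or.inl hx
          · exact Or.inl hy
      · by_cases hyA : y ∈ A
        · exact h1 fun v hv => by
            rcases Sym2.mem_iff.1 hv with rfl | rfl
            · exact Or.inl hx
            · exact Or.inr hyA
        · exact key x y rfl hx hy hyA
    · by_cases hy : y ∈ VB
      · by_cases hxA : x ∈ A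
        · exact h1 fun v hv => by
            rcases Sym2.mem_iff.1 hv with rfl | rfl
            · exact Or.inr hxA
            · exact Or.inl hy
        · exact key y x Sym2.eq_swap hy hx hxA
      · refine h2 ⟨fun v hv => ?_, fun hall => h1 fun v hv => Or.inr (hall v hv)⟩
        rcases Sym2.mem_iff.1 hv with rfl | rfl
        · exact hx
        · exact hy

end FaceRankOne

end Summit.CriticalPhenomena.PercolationContinuityZ3.Theorems
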